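import Mathlib
import HarnessLib
import Summits.HubbardSuperconductivity.HubbardSuperconductivity.Theorems.KLProgrammeKLRegimeVolumeLimitCutoffDoorsV14

/-!
# VL child `KLRegimeVolumeLimitV14` (stmt-HubbardSuperconductivity-19921), skeleton «cauchy» v2 (6f46346070479240):
# NESTED VOLUMES SUFFICE for the engine-lineage stub `stub_vl_rates`
# (cell gate-hubbard-kl, seat hubbard-kl-k3c5-p3 g5, technique «OS-positivity-free direct assembly»; `--supports` 19921)

The registered stub `stub_vl_rates` of «cauchy» v2 asks, in the KL regime and for the CUTOFF-FREE bare quantities of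
`…VolumeLimitCutoffFreeDefs`, (b1) a two-volume rate of the density `klOccInf L β U μ` and (b2) a two-volume rate WITH CROSS-GRID
MOMENTUM MODULUS of the six-point scalar `klSixInf L β U μ n k`, for ARBITRARY volume pairs `L ≤ L′` (whose momentum grids
`(2π/L)ℤ²`, `(2π/L′)ℤ²` are in general position).  This module shows that the expansion's two-volume pass never has to compare
volumes in general position, nor carry a Lipschitz constant across volumes:

**Observation.**  Any two volumes `L ≤ L′` sit inside their common multiple `L″ = L·L′`, and `grid_L, grid_{L′} ⊂ grid_{L″}` EXACTLY
(`2πv/L = 2π(vL′)/(LL′)`, `exists_lift_of_dvd`).  Hence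
`‖T_L(k) − T_{L′}(k′)‖ ≤ ‖T_L(k) − T_{L″}(ιk)‖ + ‖T_{L″}(ιk) − T_{L″}(ι′k′)‖ + ‖T_{L″}(ι′k′) − T_{L′}(k′)‖`
— two NESTED, SAME-MOMENTUM comparisons and ONE single-volume momentum modulus.  So (b2) follows from
* (b2n) a NESTED rate: `L ∣ L″`, `p_{k″} = p_k` ⇒ `‖T_L n k − T_{L″} n k″‖ ≤ ρ L`, `ρ → 0`, and
* (b2m) a ONE-VOLUME modulus: `‖T_L n k₁ − T_L n k₂‖ ≤ ρ′ L + D·Σ_i |p_{k₁} i − p_{k₂} i|_𝕋`, `ρ′ → 0`,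
with the rate `2ρ̂ L + ρ̂′ L` (antitone envelopes `ρ̂ ≥ ρ`, `exists_antitone_majorant`, absorb `ρ(L′)` and `ρ′(LL′)`) and the SAME `D`
(`twoVolumeRate_of_nestedRate`, any grid family, any label type); (b1) likewise from nested density comparisons
(`scalarRate_of_nestedRate`).  In position space the restriction of a `grid_{L″}` function to `grid_L` is the PERIODISATION
`Λ_{L″} → Λ_L` of its site kernel (Poisson on nested tori), so (b2n) is the `ℓ¹`-comparability of the torus-`L` kernel with the
periodised torus-`L″` kernel — a statement about two FINITE volumes (no limit objects, no sitewise limits, no cross-grid refinement),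
which is what an inductive two-volume pass of the expansion produces; (b2m) follows from an `L`-uniform first site moment.

* `exists_antitone_majorant` — a real sequence tending to `0` has an antitone non-negative majorant tending to `0`;
* `exists_lift_of_dvd` — `L ∣ L″` ⇒ every torus momentum of `grid_L` is a torus momentum of `grid_{L″}`;
* `scalarRate_of_nestedRate`, `twoVolumeRate_of_nestedRate` — the abstract reductions;
* `stub_vl_rates_of_nested_V14` — **the registered `stub_vl_rates` text of «cauchy» v2 VERBATIM from (b1n) + (b2n) + (b2m)** stated in the
  stub's own regime prefix (two hypothesis blocks: the nested rates — the two-volume pass — and the one-volume modulus — sizes).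

Everything is proved; no definition; nothing is asserted about the model.
-/

noncomputable section

namespace Summit.HubbardSuperconductivity.HubbardSuperconductivity.Theorems.TwoPointAssembly

set_option linter.dupNamespace false -- summit = problem name (single-conjunct summit), D-0017

open Finset Filter Topology Literature.MathematicalPhysics.QuantumLattice Literature.Probability.LatticeModels
open Literature.MathematicalPhysics.QuantumLattice.FermiRG
open Summit.HubbardSuperconductivity.HubbardSuperconductivity.Theorems.KLRegimeSplit
open Summit.HubbardSuperconductivity.HubbardSuperconductivity.Theorems.KLProgrammeLegKernels

/-! ## §1 Antitone envelopes of null sequences -/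

/-- **Antitone envelope.**  A real sequence `ρ → 0` has a majorant `ρ̂ ≥ ρ`, `ρ̂ ≥ 0`, antitone, `ρ̂ → 0`
(`ρ̂ n = sup_{m ≥ n} max (ρ m) 0`). [folklore] -/
theorem exists_antitone_majorant {ρ : ℕ → ℝ} (hρ : Tendsto ρ atTop (𝓝 0)) :
    ∃ σ : ℕ → ℝ, Antitone σ ∧ Tendsto σ atTop (𝓝 0) ∧ (∀ n, ρ n ≤ σ n) ∧ ∀ n, 0 ≤ σ n := by
  set u : ℕ → ℝ := fun n => max (ρ n) 0 with hu
  have hu0 : Tendsto u atTop (𝓝 0) := by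
    have h := hρ.max (tendsto_const_nhds (x := (0 : ℝ)))
    simpa [hu] using h
  have hbdd : BddAbove (Set.range u) := hu0.bddAbove_range
  have hbddn : ∀ n, BddAbove (u '' Set.Ici n) := fun n => hbdd.mono (Set.image_subset_range _ _)
  have hne : ∀ n, (u '' Set.Ici n).Nonempty := fun n => ⟨u n, n, Set.mem_Ici.2 le_rfl, rfl⟩
  have hun : ∀ n, u n ≤ sSup (u '' Set.Ici n) := fun n => le_csSup (hbddn n) ⟨n, Set.mem_Ici.2 le_rfl, rfl⟩
  refine ⟨fun n => sSup (u '' Set.Ici n), ?_, ?_, fun n => (le_max_left _ _).trans (hun n),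
    fun n => (le_max_right _ _).trans (hun n)⟩
  · intro n m hnm
    exact csSup_le_csSup (hbddn n) (hne m) (Set.image_mono (Set.Ici_subset_Ici.2 hnm))
  · refine Metric.tendsto_atTop.2 fun ε hε => ?_
    obtain ⟨N, hN⟩ := Metric.tendsto_atTop.1 hu0 (ε / 2) (half_pos hε)
    refine ⟨N, fun n hn => ?_⟩
    have hle : sSup (u '' Set.Ici n) ≤ ε / 2 := by
      refine csSup_le (hne n) ?_
      rintro _ ⟨m, hm, rfl⟩
      have h := hN m (le_trans hn (Set.mem_Ici.1 hm))
      rw [Real.dist_eq, sub_zero] at h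
      exact (le_abs_self _).trans h.le
    have hge : 0 ≤ sSup (u '' Set.Ici n) := (le_max_right _ _).trans (hun n)
    rw [Real.dist_eq, sub_zero, abs_of_nonneg hge]
    linarith

/-! ## §2 Nested momentum grids -/

/-- **`L ∣ L″` ⇒ `grid_L ⊂ grid_{L″}`**: every torus momentum of the volume `L` is (exactly) a torus momentum of the volume `L″`
(`k″_i = (L″/L)·k_i`). [folklore] -/
theorem exists_lift_of_dvd {L L'' : ℕ} [NeZero L] [NeZero L''] (h : L ∣ L'') (k : TorusSite 2 L) :
    ∃ k'' : TorusSite 2 L'', latticeMomentum L'' k'' = latticeMomentum L k := by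
  obtain ⟨m, hm⟩ := h
  have hL : L ≠ 0 := NeZero.ne L
  have hm0 : m ≠ 0 := by
    rintro rfl
    exact NeZero.ne L'' (by simpa using hm)
  refine ⟨fun i => (((k i).val * m : ℕ) : ZMod L''), funext fun i => ?_⟩
  simp only [latticeMomentum]
  have hlt : (k i).val * m < L'' := by
    rw [hm]
    exact Nat.mul_lt_mul_of_lt_of_le (ZMod.val_lt (k i)) le_rfl (Nat.pos_of_ne_zero hm0)
  rw [ZMod.val_natCast, Nat.mod_eq_of_lt hlt, hm]
  have hLR : (L : ℝ) ≠ 0 := by exact_mod_cast hL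
  have hmR : (m : ℝ) ≠ 0 := by exact_mod_cast hm0
  push_cast
  field_simp

/-! ## §3 The abstract reductions -/

/-- **Scalars: nested comparisons give all comparisons.**  If `‖a_L − a_{L″}‖ ≤ ρ L` whenever `L₀ ≤ L ∣ L″` with `ρ → 0`, then
`‖a_L − a_{L′}‖ ≤ ρ₁ L` for all `L₀ ≤ L ≤ L′` with `ρ₁ → 0` (`ρ₁ = 2ρ̂`, through `L″ = L·L′`). [folklore] -/
theorem scalarRate_of_nestedRate {a : ∀ (L : ℕ) [NeZero L], ℂ} {L₀ : ℕ} {ρ : ℕ → ℝ} (hρ : Tendsto ρ atTop (𝓝 0))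
    (hnest : ∀ (L : ℕ) [NeZero L], L₀ ≤ L → ∀ (L'' : ℕ) [NeZero L''], L ∣ L'' → ‖a L - a L''‖ ≤ ρ L) :
    ∃ ρ₁ : ℕ → ℝ, Tendsto ρ₁ atTop (𝓝 0) ∧
      ∀ (L : ℕ) [NeZero L], L₀ ≤ L → ∀ (L' : ℕ) [NeZero L'], L ≤ L' → ‖a L - a L'‖ ≤ ρ₁ L := by
  obtain ⟨σ, hσa, hσ0, hρσ, -⟩ := exists_antitone_majorant hρ
  refine ⟨fun L => 2 * σ L, by simpa using hσ0.const_mul 2, fun L _ hL L' _ hLL' => ?_⟩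
  haveI : NeZero (L * L') := ⟨mul_ne_zero (NeZero.ne L) (NeZero.ne L')⟩
  have h1 := hnest L hL (L * L') (dvd_mul_right L L')
  have h2 := hnest L' (hL.trans hLL') (L * L') (dvd_mul_left L' L)
  calc ‖a L - a L'‖ ≤ ‖a L - a (L * L')‖ + ‖a (L * L') - a L'‖ := norm_sub_le_norm_sub_add_norm_sub _ _ _
    _ ≤ ρ L + ρ L' := by rw [norm_sub_rev (a (L * L'))]; exact add_le_add h1 h2
    _ ≤ σ L + σ L := add_le_add (hρσ L) ((hρσ L').trans (hσa hLL'))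
    _ = 2 * σ L := by ring

/-- **Grid families: a NESTED same-momentum rate and a ONE-volume momentum modulus give the two-volume rate with cross-grid
modulus for ALL volume pairs** (same modulus constant `D`; rate `2ρ̂ + ρ̂′`).  `T L i k` is any volume-indexed family on the torus
momentum grid with labels `i : ι` (rates uniform in the label). [folklore] -/
theorem twoVolumeRate_of_nestedRate {ι : Type*} {T : ∀ (L : ℕ) [NeZero L], ι → TorusSite 2 L → ℂ} {L₀ : ℕ} {D : ℝ}
    {ρ ρ' : ℕ → ℝ} (hρ : Tendsto ρ atTop (𝓝 0)) (hρ' : Tendsto ρ' atTop (𝓝 0))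
    (hnest : ∀ (L : ℕ) [NeZero L], L₀ ≤ L → ∀ (L'' : ℕ) [NeZero L''], L ∣ L'' →
      ∀ (i : ι) (k : TorusSite 2 L) (k'' : TorusSite 2 L''), latticeMomentum L'' k'' = latticeMomentum L k →
        ‖T L i k - T L'' i k''‖ ≤ ρ L)
    (hmod : ∀ (L : ℕ) [NeZero L], L₀ ≤ L → ∀ (i : ι) (k₁ k₂ : TorusSite 2 L),
      ‖T L i k₁ - T L i k₂‖ ≤ ρ' L + D * ∑ j, torusAbs (latticeMomentum L k₁ j - latticeMomentum L k₂ j)) :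
    ∃ ρ₂ : ℕ → ℝ, Tendsto ρ₂ atTop (𝓝 0) ∧
      ∀ (L : ℕ) [NeZero L], L₀ ≤ L → ∀ (L' : ℕ) [NeZero L'], L ≤ L' →
        ∀ (i : ι) (k : TorusSite 2 L) (k' : TorusSite 2 L'),
          ‖T L i k - T L' i k'‖ ≤ ρ₂ L + D * ∑ j, torusAbs (latticeMomentum L k j - latticeMomentum L' k' j) := by
  obtain ⟨σ, hσa, hσ0, hρσ, -⟩ := exists_antitone_majorant hρ
  obtain ⟨σ', hσ'a, hσ'0, hρσ', -⟩ := exists_antitone_majorant hρ'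
  refine ⟨fun L => 2 * σ L + σ' L, by simpa using (hσ0.const_mul 2).add hσ'0, fun L _ hL L' _ hLL' i k k' => ?_⟩
  haveI : NeZero (L * L') := ⟨mul_ne_zero (NeZero.ne L) (NeZero.ne L')⟩
  obtain ⟨q, hq⟩ := exists_lift_of_dvd (dvd_mul_right L L') k
  obtain ⟨q', hq'⟩ := exists_lift_of_dvd (dvd_mul_left L' L) k'
  have hLm : L ≤ L * L' := Nat.le_mul_of_pos_right L (Nat.pos_of_ne_zero (NeZero.ne L'))
  have h1 := hnest L hL (L * L') (dvd_mul_right L L') i k q hq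
  have h3 := hnest L' (hL.trans hLL') (L * L') (dvd_mul_left L' L) i k' q' hq'
  have h2 := hmod (L * L') (hL.trans hLm) i q q'
  rw [hq, hq'] at h2
  have hnn : 0 ≤ ∑ j, torusAbs (latticeMomentum L k j - latticeMomentum L' k' j) := klvc_tmod_nonneg _ _
  calc ‖T L i k - T L' i k'‖
      ≤ ‖T L i k - T (L * L') i q‖ + ‖T (L * L') i q - T L' i k'‖ := norm_sub_le_norm_sub_add_norm_sub _ _ _
    _ ≤ ‖T L i k - T (L * L') i q‖ + (‖T (L * L') i q - T (L * L') i q'‖ + ‖T (L * L') i q' - T L' i k'‖) := by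
        gcongr
        exact norm_sub_le_norm_sub_add_norm_sub _ _ _
    _ ≤ ρ L + ((ρ' (L * L') + D * ∑ j, torusAbs (latticeMomentum L k j - latticeMomentum L' k' j)) + ρ L') := by
        rw [norm_sub_rev (T (L * L') i q') (T L' i k')]
        gcongr
    _ ≤ σ L + ((σ' L + D * ∑ j, torusAbs (latticeMomentum L k j - latticeMomentum L' k' j)) + σ L) := by
        gcongr
        · exact hρσ L
        · exact (hρσ' _).trans (hσ'a hLm)
        · exact (hρσ L').trans (hσa hLL')
    _ = (2 * σ L + σ' L) + D * ∑ j, torusAbs (latticeMomentum L k j - latticeMomentum L' k' j) := by ring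

/-! ## §4 The registered `stub_vl_rates` text of «cauchy» v2 from nested rates and a one-volume modulus -/

/-- **`stub_vl_rates` (stmt-…-19921, «cauchy» v2) FROM NESTED DATA.**  IF, for every datum of the registered stub (constant records, regime
point, admissible frame, tower), (N) the density and the six-point scalar have NESTED rates — `L₀ ≤ L ∣ L″` ⇒
`‖klOccInf L − klOccInf L″‖ ≤ ρ₁ L` and, at equal torus momenta, `‖klSixInf L n k − klSixInf L″ n k″‖ ≤ ρ₂ L`, `ρ₁, ρ₂ → 0` — and (M) the
six-point scalar has a ONE-VOLUME momentum modulus `‖klSixInf L n k₁ − klSixInf L n k₂‖ ≤ ρ₃ L + D·Σ_i |p_{k₁} i − p_{k₂} i|_𝕋`, `ρ₃ → 0`,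
THEN the registered text of `stub_vl_rates` holds verbatim (arbitrary volume pairs, cross-grid modulus with the same `D`). -/
theorem stub_vl_rates_of_nested_V14
    (hN : ∀ (G : GeoConsts) (P : SplitConsts) (Q : EngConsts) (R : RenConsts), G.WF → P.WF → Q.WF → R.WF →
      ∃ c₅ : ℝ, 0 < c₅ ∧ ∀ c : ℝ, 0 < c → c ≤ c₅ → ∃ U₀ : ℝ, 0 < U₀ ∧
        ∀ μ ∈ klWindowC, ∀ U : ℝ, 0 < U → U ≤ U₀ → ∀ β : ℝ, klBetaMin ≤ β → β ≤ Real.exp (c / U ^ 2) →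
          ∀ K : TrigPolyC4v, klPredsV14.frameOK R U (nScales β) μ K →
            ∀ (Lstar : ℕ) (Mstar : ℕ → ℕ), TowerP klPredsV14 G P Q R β U μ K Lstar Mstar →
              ∃ L₀ : ℕ, ∃ ρ₁ : ℕ → ℝ, ∃ ρ₂ : ℕ → ℝ, Tendsto ρ₁ atTop (𝓝 0) ∧ Tendsto ρ₂ atTop (𝓝 0) ∧
                (∀ (L : ℕ) [NeZero L], L₀ ≤ L → ∀ (L'' : ℕ) [NeZero L''], L ∣ L'' →
                  ‖klOccInf L β U μ - klOccInf L'' β U μ‖ ≤ ρ₁ L) ∧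
                (∀ (L : ℕ) [NeZero L], L₀ ≤ L → ∀ (L'' : ℕ) [NeZero L''], L ∣ L'' →
                  ∀ (n : ℤ) (k : TorusSite 2 L) (k'' : TorusSite 2 L''), latticeMomentum L'' k'' = latticeMomentum L k →
                    ‖klSixInf L β U μ n k - klSixInf L'' β U μ n k''‖ ≤ ρ₂ L))
    (hM : ∀ (G : GeoConsts) (P : SplitConsts) (Q : EngConsts) (R : RenConsts), G.WF → P.WF → Q.WF → R.WF →
      ∃ c₅ : ℝ, 0 < c₅ ∧ ∀ c : ℝ, 0 < c → c ≤ c₅ → ∃ U₀ : ℝ, 0 < U₀ ∧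
        ∀ μ ∈ klWindowC, ∀ U : ℝ, 0 < U → U ≤ U₀ → ∀ β : ℝ, klBetaMin ≤ β → β ≤ Real.exp (c / U ^ 2) →
          ∀ K : TrigPolyC4v, klPredsV14.frameOK R U (nScales β) μ K →
            ∀ (Lstar : ℕ) (Mstar : ℕ → ℕ), TowerP klPredsV14 G P Q R β U μ K Lstar Mstar →
              ∃ L₀ : ℕ, ∃ D : ℝ, ∃ ρ₃ : ℕ → ℝ, Tendsto ρ₃ atTop (𝓝 0) ∧
                ∀ (L : ℕ) [NeZero L], L₀ ≤ L → ∀ (n : ℤ) (k₁ k₂ : TorusSite 2 L),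
                  ‖klSixInf L β U μ n k₁ - klSixInf L β U μ n k₂‖ ≤
                    ρ₃ L + D * ∑ i, torusAbs (latticeMomentum L k₁ i - latticeMomentum L k₂ i)) :
    ∀ (G : GeoConsts) (P : SplitConsts) (Q : EngConsts) (R : RenConsts), G.WF → P.WF → Q.WF → R.WF →
      ∃ c₅ : ℝ, 0 < c₅ ∧ ∀ c : ℝ, 0 < c → c ≤ c₅ → ∃ U₀ : ℝ, 0 < U₀ ∧
        ∀ μ ∈ klWindowC, ∀ U : ℝ, 0 < U → U ≤ U₀ → ∀ β : ℝ, klBetaMin ≤ β → β ≤ Real.exp (c / U ^ 2) →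
          ∀ K : TrigPolyC4v, klPredsV14.frameOK R U (nScales β) μ K →
            ∀ (Lstar : ℕ) (Mstar : ℕ → ℕ), TowerP klPredsV14 G P Q R β U μ K Lstar Mstar →
              ∃ L₀ : ℕ, ∃ D₂ : ℝ, ∃ ρ₁ : ℕ → ℝ, ∃ ρ₂ : ℕ → ℝ, Tendsto ρ₁ atTop (𝓝 0) ∧ Tendsto ρ₂ atTop (𝓝 0) ∧
                (∀ (L : ℕ) [NeZero L], L₀ ≤ L → ∀ (L' : ℕ) [NeZero L'], L ≤ L' → ‖klOccInf L β U μ - klOccInf L' β U μ‖ ≤ ρ₁ L) ∧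
                (∀ (L : ℕ) [NeZero L], L₀ ≤ L → ∀ (L' : ℕ) [NeZero L'], L ≤ L' →
                  ∀ (n : ℤ) (k : TorusSite 2 L) (k' : TorusSite 2 L'),
                    ‖klSixInf L β U μ n k - klSixInf L' β U μ n k'‖ ≤
                      ρ₂ L + D₂ * ∑ i, torusAbs (latticeMomentum L k i - latticeMomentum L' k' i)) := by
  intro G P Q R hG hP hQ hR
  obtain ⟨c₁, hc₁, h₁⟩ := hN G P Q R hG hP hQ hR
  obtain ⟨c₂, hc₂, h₂⟩ := hM G P Q R hG hP hQ hR
  refine ⟨min c₁ c₂, lt_min hc₁ hc₂, fun c hc hcle => ?_⟩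
  obtain ⟨U₁, hU₁, h₁'⟩ := h₁ c hc (hcle.trans (min_le_left _ _))
  obtain ⟨U₂, hU₂, h₂'⟩ := h₂ c hc (hcle.trans (min_le_right _ _))
  refine ⟨min U₁ U₂, lt_min hU₁ hU₂, ?_⟩
  intro μ hμ U hU hUle β hβ hβle K hK Lstar Mstar hT
  obtain ⟨L₁, ρ₁, ρ₂, hρ₁, hρ₂, hocc, hsix⟩ := h₁' μ hμ U hU (hUle.trans (min_le_left _ _)) β hβ hβle K hK Lstar Mstar hT
  obtain ⟨L₂, D, ρ₃, hρ₃, hmod⟩ := h₂' μ hμ U hU (hUle.trans (min_le_right _ _)) β hβ hβle K hK Lstar Mstar hT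
  -- (b1): nested density comparisons give all comparisons
  obtain ⟨ρ₁', hρ₁', hocc'⟩ := scalarRate_of_nestedRate (a := fun L _ => klOccInf L β U μ) (L₀ := max L₁ L₂) hρ₁
    (fun L _ hL L'' _ hdvd => hocc L (le_of_max_le_left hL) L'' hdvd)
  -- (b2): nested rate + one-volume modulus give the cross-grid rate
  obtain ⟨ρ₂', hρ₂', hsix'⟩ := twoVolumeRate_of_nestedRate (T := fun L _ n k => klSixInf L β U μ n k) (L₀ := max L₁ L₂) (D := D)
    hρ₂ hρ₃ (fun L _ hL L'' _ hdvd n k k'' hkk => hsix L (le_of_max_le_left hL) L'' hdvd n k k'' hkk)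
    (fun L _ hL n k₁ k₂ => hmod L (le_of_max_le_right hL) n k₁ k₂)
  exact ⟨max L₁ L₂, D, ρ₁', ρ₂', hρ₁', hρ₂', fun L _ hL L' _ hLL' => hocc' L hL L' hLL',
    fun L _ hL L' _ hLL' n k k' => hsix' L hL L' hLL' n k k'⟩

end Summit.HubbardSuperconductivity.HubbardSuperconductivity.Theorems.TwoPointAssembly

end
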